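import Literature.Analysis.FluidPDE.PassiveScalarDiagForcedRestart
import HarnessLib

/-!
# Restart of global weak diagonal-diffusion passive scalars; integer multiples of the period

Analysis/FluidPDE proof-support file (everything proved). Corollaries of the restart theorem
`IsWeakScalarTransportDiagForcedOn.translate` (`PassiveScalarDiagForcedRestart`) for the global
class `Torus.IsWeakScalarTransportDiagForced a κ u s θ₀ θ` (weak solutions of
`∂ₜθ + u·∇θ = κ ∑ᵢ aᵢ ∂ᵢ∂ᵢθ + s` on `T^d × [0,T)` for every `T > 0`; DiPerna–Lions 1989, §II.1):

* `IsWeakScalarTransportDiagForced.translate` — restart at `σ ≥ 0` from a datum satisfying the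
  trace identities at `σ` (horizon by horizon);
* `….exists_trace_translate` — every global weak solution has an `L²` trace datum at every
  `σ ≥ 0` (the slice of the weakly continuous representative, `PassiveScalarDiagForcedTrace`),
  from which the translate `t ↦ θ(σ + t)` is a global weak solution with drift `u(σ + ·)` and
  source `s(σ + ·)`;
* `….restart_natMulPeriod`, `….exists_trace_restart_natMulPeriod` — the "integer periods" form
  consumed by the scalar zeroth-law bookkeeping of cell `ad-ideate` (ROUND-10 §B3, ROUND-11 §2.1
  (T3)): for a drift `L`-periodic on `t ≥ 0` and a steady source, `t ↦ θ(nL + t)` is again a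
  global weak solution with the SAME drift and source, from the (`L²`, a.e. unique) trace datum
  at `nL` (`IsWeakScalarTransportDiagForcedOn.intPhase_iff_of_steady`).

## References

* R. J. DiPerna, P.-L. Lions, Invent. Math. 98 (1989), §II.1, (12)–(14), §II.3. [`DiPernaLions1989`]
* A. Pazy, *Semigroups of Linear Operators and Applications to PDE* (Springer 1983), Ch. 5,
  §5.1–5.2. [`Pazy1983`]
-/

noncomputable section

open _root_.MeasureTheory _root_.Set _root_.Filter _root_.Function _root_.TopologicalSpace
open scoped ENNReal NNReal InnerProductSpace ContDiff

namespace Literature.Analysis.FluidPDE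

namespace Torus

open Literature.Analysis.FunctionSpaces.Torus Literature.Analysis.FunctionSpaces

variable {d : Type*} [Fintype d] [DecidableEq d]

/-! ## The representative is a weak solution and restarts from its own slices -/

namespace IsWeakScalarTransportDiagForcedOn

variable {T κ : ℝ} {a : d → ℝ} {u : ℝ → UnitAddTorus d → EuclideanSpace ℝ d}
  {s : ℝ → UnitAddTorus d → ℝ} {θ₀ : UnitAddTorus d → ℝ} {θ : ℝ → UnitAddTorus d → ℝ}

/-- **The mean of a trace datum**: if `θσ` satisfies the trace identities of a weak solution at
`σ`, then `∫ θσ = ∫ θ₀ + ∫_{(0,σ]} ∫ s(τ) dτ` (`g = 1`; for a mean-zero datum and a mean-zero source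
every trace datum is mean-zero). [cite: DiPernaLions1989, §II.1 (12)–(14)] -/
theorem integral_trace_eq (_h : IsWeakScalarTransportDiagForcedOn T a κ u s θ₀ θ) {σ : ℝ}
    {θσ : UnitAddTorus d → ℝ}
    (htr : ∀ g : UnitAddTorus d → ℝ, IsSmooth g →
      ∫ x, θσ x * g x = (∫ x, θ₀ x * g x) +
        ∫ τ in Ioc 0 σ, ((∫ x, θ τ x * (⟪u τ x, gradient g x⟫_ℝ +
          κ * ∑ i, a i * FunctionSpaces.Torus.partialDeriv i (FunctionSpaces.Torus.partialDeriv i g) x)) +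
          ∫ x, s τ x * g x)) :
    ∫ x, θσ x = (∫ x, θ₀ x) + ∫ τ in Ioc 0 σ, ∫ x, s τ x := by
  have h1 := htr (fun _ => (1 : ℝ)) (isSmooth_const (1 : ℝ))
  have hg0 : ∀ x : UnitAddTorus d, gradient (fun _ : UnitAddTorus d => (1 : ℝ)) x = 0 := by
    intro x
    have hl : liftAt (fun _ : UnitAddTorus d => (1 : ℝ)) x = fun _ => 1 := by
      funext v; simp [liftAt_apply]
    simp [FunctionSpaces.Torus.gradient, hl]
  have hl0 : ∀ (i : d) (x : UnitAddTorus d), FunctionSpaces.Torus.partialDeriv i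
      (FunctionSpaces.Torus.partialDeriv i (fun _ : UnitAddTorus d => (1 : ℝ))) x = 0 := by
    intro i x
    simp [FunctionSpaces.Torus.partialDeriv, FunctionSpaces.Torus.lineDeriv]
  simpa [hg0, hl0] using h1

/-- **The weakly continuous representative is a weak solution which restarts from its own
slices.** For `T > 0` the representative `w` of `PassiveScalarDiagForcedTrace` (jointly
measurable, `w(t) ∈ L²` with `∫ w(t)² ≤ C` for all `t ≥ 0`, `w(t) = θ(t)` a.e. for a.e.
`t ∈ (0,T)`, `t ↦ ∫ w(t) g` continuous on `[0,T]` for `g ∈ L²`) is itself a weak solution on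
`[0,T)` from `θ₀` (`congr_ae_slice`), and for EVERY `σ ∈ [0,T)` its translate `t ↦ w(σ + t)` is a
weak solution on `[0, T - σ)` with drift `u(σ + ·)`, source `s(σ + ·)` and datum `w(σ)` — the
evolution property in the class `C([0,T]; L²_w)`. [cite: DiPernaLions1989, §II.1 (12)–(14)] -/
theorem exists_representative_solution [Nonempty d] (hT : 0 < T)
    (h : IsWeakScalarTransportDiagForcedOn T a κ u s θ₀ θ) :
    ∃ w : ℝ → UnitAddTorus d → ℝ,
      AEStronglyMeasurable (stLift w) (volume.restrict (Ioi 0 ×ˢ univ)) ∧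
      (∀ t, 0 ≤ t → MemLp (w t) 2 volume) ∧
      (∃ C : ℝ≥0, ∀ t, 0 ≤ t → ∫ x, w t x ^ 2 ≤ C) ∧
      (∀ᵐ t ∂(volume.restrict (Ioo 0 T)), w t =ᵐ[volume] θ t) ∧
      (∀ g : UnitAddTorus d → ℝ, MemLp g 2 volume →
        ContinuousOn (fun t => ∫ x, w t x * g x) (Icc 0 T)) ∧
      IsWeakScalarTransportDiagForcedOn T a κ u s θ₀ w ∧
      ∀ σ ∈ Ico 0 T, IsWeakScalarTransportDiagForcedOn (T - σ) a κ (fun t => u (σ + t))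
        (fun t => s (σ + t)) (w σ) (fun t => w (σ + t)) := by
  obtain ⟨w, hwm, hw2, hwC, hae, hwc, htr⟩ := h.exists_weaklyContinuous_representative hT
  have hwmT : AEStronglyMeasurable (stLift w) (volume.restrict (Ioo 0 T ×ˢ univ)) :=
    hwm.mono_measure (Measure.restrict_mono_set _ (prod_mono Ioo_subset_Ioi_self le_rfl))
  have hw : IsWeakScalarTransportDiagForcedOn T a κ u s θ₀ w := h.congr_ae_slice hwmT hae
  refine ⟨w, hwm, hw2, hwC, hae, hwc, hw, fun σ hσ => hw.translate hσ.1 hσ.2 fun g hg => ?_⟩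
  -- the trace identities of `w` at `σ`: those of `θ`, with `θ` replaced by `w` (`= θ` a.e.) inside
  rw [htr g hg σ (Ico_subset_Icc_self hσ)]
  congr 1
  refine integral_congr_ae ?_
  filter_upwards [ae_restrict_of_ae_restrict_of_subset (Ioc_subset_Ioo_right hσ.2) hae] with τ hτ
  congr 1
  exact integral_congr_ae (hτ.mono fun x hx => by simp only [hx])

end IsWeakScalarTransportDiagForcedOn

/-! ## The global class -/

namespace IsWeakScalarTransportDiagForced

variable {κ : ℝ} {a : d → ℝ} {u : ℝ → UnitAddTorus d → EuclideanSpace ℝ d}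
  {s : ℝ → UnitAddTorus d → ℝ} {θ₀ : UnitAddTorus d → ℝ} {θ : ℝ → UnitAddTorus d → ℝ}

/-- **Restart of global weak solutions from a trace datum**: if `θσ` satisfies the trace
identities at `σ ≥ 0` (which involve `θ`, `u`, `s` on `(0,σ]` only), the translate
`t ↦ θ(σ + t)` is a global weak solution with drift `u(σ + ·)`, source `s(σ + ·)`, datum `θσ`
(horizon by horizon, `IsWeakScalarTransportDiagForcedOn.translate` with `T = σ + T'`).
[cite: DiPernaLions1989, §II.1 (12)–(14)] -/
theorem translate (h : IsWeakScalarTransportDiagForced a κ u s θ₀ θ) {σ : ℝ} (hσ : 0 ≤ σ)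
    {θσ : UnitAddTorus d → ℝ}
    (htr : ∀ g : UnitAddTorus d → ℝ, IsSmooth g →
      ∫ x, θσ x * g x = (∫ x, θ₀ x * g x) +
        ∫ τ in Ioc 0 σ, ((∫ x, θ τ x * (⟪u τ x, gradient g x⟫_ℝ +
          κ * ∑ i, a i * FunctionSpaces.Torus.partialDeriv i (FunctionSpaces.Torus.partialDeriv i g) x)) +
          ∫ x, s τ x * g x)) :
    IsWeakScalarTransportDiagForced a κ (fun t => u (σ + t)) (fun t => s (σ + t)) θσ
      (fun t => θ (σ + t)) := by
  intro T' hT'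
  have key := (h (σ + T') (by linarith)).translate hσ (by linarith) htr
  rwa [add_sub_cancel_left] at key

/-- **Every global weak solution has an `L²` trace at every time `σ ≥ 0`, from which it
restarts**: there is `θσ ∈ L²(T^d)` satisfying the trace identities at `σ` (unique a.e. among
integrable data, `IsWeakScalarTransportDiagForcedOn.trace_unique`) such that `t ↦ θ(σ + t)` is a
global weak solution with drift `u(σ + ·)`, source `s(σ + ·)` and datum `θσ` (the slice at `σ` of
the weakly continuous representative on the horizon `σ + 1`). [cite: DiPernaLions1989, §II.1 (12)–(14)] -/
theorem exists_trace_translate [Nonempty d] (h : IsWeakScalarTransportDiagForced a κ u s θ₀ θ)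
    {σ : ℝ} (hσ : 0 ≤ σ) :
    ∃ θσ : UnitAddTorus d → ℝ, MemLp θσ 2 volume ∧
      (∀ g : UnitAddTorus d → ℝ, IsSmooth g →
        ∫ x, θσ x * g x = (∫ x, θ₀ x * g x) +
          ∫ τ in Ioc 0 σ, ((∫ x, θ τ x * (⟪u τ x, gradient g x⟫_ℝ +
            κ * ∑ i, a i * FunctionSpaces.Torus.partialDeriv i (FunctionSpaces.Torus.partialDeriv i g) x)) +
            ∫ x, s τ x * g x)) ∧
      IsWeakScalarTransportDiagForced a κ (fun t => u (σ + t)) (fun t => s (σ + t)) θσ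
        (fun t => θ (σ + t)) := by
  have hT : 0 < σ + 1 := by linarith
  obtain ⟨w, -, hw2, -, -, -, htr⟩ := (h (σ + 1) hT).exists_weaklyContinuous_representative hT
  have hσI : σ ∈ Icc 0 (σ + 1) := ⟨hσ, by linarith⟩
  exact ⟨w σ, hw2 σ hσ, fun g hg => htr g hg σ hσI, h.translate hσ fun g hg => htr g hg σ hσI⟩

/-- **Restart at integer multiples of the period (the form used by charge–discharge
bookkeeping).** For a drift `u` which is `L`-periodic on `t ≥ 0` (`L ≥ 0`) and a steady source
`S`, a global weak solution `θ` restarted at `σ = nL` from a trace datum `θσ` is again a global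
weak solution with the SAME drift `u` and source `S`: `t ↦ θ(nL + t)` solves
`∂ₜθ + u·∇θ = κ ∑ᵢ aᵢ ∂ᵢ∂ᵢθ + S` on `T^d × [0,∞)` with datum `θσ` (`translate` and
`IsWeakScalarTransportDiagForcedOn.intPhase_iff_of_steady`). [cite: DiPernaLions1989, §II.1 (12)–(14)] -/
theorem restart_natMulPeriod {S : UnitAddTorus d → ℝ} {L : ℝ} (hL : 0 ≤ L)
    (hu : ∀ t : ℝ, 0 ≤ t → u (t + L) = u t)
    (h : IsWeakScalarTransportDiagForced a κ u (fun _ => S) θ₀ θ) (n : ℕ) {θσ : UnitAddTorus d → ℝ}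
    (htr : ∀ g : UnitAddTorus d → ℝ, IsSmooth g →
      ∫ x, θσ x * g x = (∫ x, θ₀ x * g x) +
        ∫ τ in Ioc 0 ((n : ℝ) * L), ((∫ x, θ τ x * (⟪u τ x, gradient g x⟫_ℝ +
          κ * ∑ i, a i * FunctionSpaces.Torus.partialDeriv i (FunctionSpaces.Torus.partialDeriv i g) x)) +
          ∫ x, S x * g x)) :
    IsWeakScalarTransportDiagForced a κ u (fun _ => S) θσ (fun t => θ ((n : ℝ) * L + t)) := by
  intro T' hT'
  have key := h.translate (σ := (n : ℝ) * L) (by positivity) htr T' hT'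
  exact (IsWeakScalarTransportDiagForcedOn.intPhase_iff_of_steady (T := T') (a := a) (κ := κ)
    (θ₀ := θσ) (θ := fun t => θ ((n : ℝ) * L + t)) hL hu n).1 key

/-- **Trace, restart and period shift combined**: for an `L`-periodic drift (`L ≥ 0`) and a
steady source, every global weak solution has at each `σ = nL` an `L²` trace datum `θₙ`
(satisfying the trace identities at `nL`) from which `t ↦ θ(nL + t)` is a global weak solution
with the same drift and source. [cite: DiPernaLions1989, §II.1 (12)–(14)] -/
theorem exists_trace_restart_natMulPeriod [Nonempty d] {S : UnitAddTorus d → ℝ} {L : ℝ} (hL : 0 ≤ L)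
    (hu : ∀ t : ℝ, 0 ≤ t → u (t + L) = u t)
    (h : IsWeakScalarTransportDiagForced a κ u (fun _ => S) θ₀ θ) (n : ℕ) :
    ∃ θₙ : UnitAddTorus d → ℝ, MemLp θₙ 2 volume ∧
      (∀ g : UnitAddTorus d → ℝ, IsSmooth g →
        ∫ x, θₙ x * g x = (∫ x, θ₀ x * g x) +
          ∫ τ in Ioc 0 ((n : ℝ) * L), ((∫ x, θ τ x * (⟪u τ x, gradient g x⟫_ℝ +
            κ * ∑ i, a i * FunctionSpaces.Torus.partialDeriv i (FunctionSpaces.Torus.partialDeriv i g) x)) +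
            ∫ x, S x * g x)) ∧
      IsWeakScalarTransportDiagForced a κ u (fun _ => S) θₙ (fun t => θ ((n : ℝ) * L + t)) := by
  obtain ⟨θₙ, hθₙ, htr, -⟩ := h.exists_trace_translate (σ := (n : ℝ) * L) (by positivity)
  exact ⟨θₙ, hθₙ, htr, restart_natMulPeriod hL hu h n htr⟩

end IsWeakScalarTransportDiagForced

end Torus

end Literature.Analysis.FluidPDE

end
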